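import Literature.AlgebraicGeometry.Resolution.BlowupStrictTransform
import Literature.AlgebraicGeometry.Resolution.BlowupsExistence
import Literature.AlgebraicGeometry.Resolution.BlowupsProperProofs
import Literature.AlgebraicGeometry.Resolution.BlowupsIntegral
import Literature.AlgebraicGeometry.Resolution.BlowupChartMembership
import Literature.AlgebraicGeometry.Resolution.StalkIdealLemmas
import Literature.AlgebraicGeometry.Resolution.BirationalLocalIso
import Literature.AlgebraicGeometry.Resolution.AlterationsResolution
import Summits.ResolutionOfSingularities.ResolutionOfSingularities.Theorems.FrobeniusLadderFInjectiveMacaulayficationRegularBlowupModelDim2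
import Mathlib.AlgebraicGeometry.ZariskisMainTheorem
import Mathlib.AlgebraicGeometry.Morphisms.QuasiFinite
import Mathlib.AlgebraicGeometry.Noetherian
import HarnessLib

/-!
# Strict transforms under a blowing up: a NON-CLOSED point over `b` when `J·𝒪_{B,b}` is not invertible
# (scheme half of WITNESS 2 — crux `FInjectiveMacaulayfication` stmt-ResolutionOfSingularities-15315, chain w45a; res-L1-w45a-plan-1 R16.39 (0) /
# R16.41 (2) «stub-2 TAKES (i)+(ii) as ONE def-free plumbing file, stub-3 imports it»; seat res-L1-w45a-stub-2)

[OURS · L1 W4.5a] Support file (`--supports stmt-ResolutionOfSingularities-15315 --as helper`); NOT a statement of any manuscript; def-free, unconditional;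
AI-written (AI review is weaker than expert review).

SETTING. `π : X₂ → X₁` a blowing up along `J` (`IsBlowup`), `i : B → X₁` a closed immersion. (A) `exists_strictTransform`: the blowing up
`ρ : B′ → B` along `J·𝒪_B = J.comap i` maps to `X₂` by a CLOSED IMMERSION `j` with `j ≫ π = ρ ≫ i` (universal property + GW 13.96 (2), tree
`IsBlowup.isClosedImmersion_of_comp_eq`) — the strict transform of `B`. (B) `exists_eq_span_of_forall_isClosed`: for `B` integral, Noetherian,
NORMAL and `b ∈ B`, if EVERY point of `B′` over `b` is closed then `J·𝒪_{B,b}` is principal: the fibre over `b` is finite, so `b` misses the (closed)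
image of the non-quasi-finite locus; over the complementary open `V ∋ b` the proper, locally quasi-finite `ρ` is finite (Mathlib
`IsFinite.of_isProper_of_locallyQuasiFinite`), birational onto the normal `V`, hence an isomorphism (tree `isIso_morphismRestrict_of_isIntegralHom_of_normal`);
so `J·𝒪_{B,b} ≅ (J·𝒪_{B′})_{ζ₀}` is generated by one element (`IsEffectiveCartier.exists_stalkIdeal_eq_span`). (C) `exists_nonClosed_specializes`:
contrapositive packaging for the witness — if `J·𝒪_{B,b}` is NOT principal, some `ζ ∈ X₂` over `b` is NON-closed and is a specialization of the
point `η′` of `X₂` over the generic point of `B`. [cite: GortzWedhorn2020, Prop. 13.96 (2); Prop. 12.76] [cite: StacksProject, Tag 02LS]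
-/

-- single-problem summit: the doubled namespace component is forced
set_option linter.dupNamespace false

noncomputable section

namespace Summit.ResolutionOfSingularities.ResolutionOfSingularities.Theorems.FInjectiveMacaulayfication.StrictTransformNonClosed

open CategoryTheory AlgebraicGeometry TopologicalSpace IsLocalRing
open Literature.AlgebraicGeometry.Resolution
open Summit.ResolutionOfSingularities.ResolutionOfSingularities.Theorems.FInjectiveMacaulayfication

/-! ## (A) The strict transform -/

/-- **The strict transform of a closed subscheme**: the blowing up `ρ : B′ → B` of `B` along `J·𝒪_B` embeds into the blowing up of `X₁` along `J`
by a closed immersion `j` over `i`. [cite: GortzWedhorn2020, Prop. 13.96 (2)] -/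
theorem exists_strictTransform {X₁ X₂ B : Scheme.{0}} {J : X₁.IdealSheafData} {π : X₂ ⟶ X₁} (hπ : IsBlowup π J)
    (i : B ⟶ X₁) [IsClosedImmersion i] :
    ∃ (B' : Scheme.{0}) (ρ : B' ⟶ B) (j : B' ⟶ X₂), IsBlowup ρ (J.comap i) ∧ IsClosedImmersion j ∧ j ≫ π = ρ ≫ i := by
  obtain ⟨B', ρ, hρ⟩ := exists_isBlowup B (J.comap i)
  have hcart : IsEffectiveCartier (J.comap (ρ ≫ i)) := by
    rw [Scheme.IdealSheafData.comap_comp]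
    exact hρ.isEffectiveCartier
  exact ⟨B', ρ, hπ.lift (ρ ≫ i) hcart, hρ, hπ.isClosedImmersion_of_comp_eq hρ (hπ.lift_comp _ _), hπ.lift_comp _ _⟩

/-! ## Helpers -/

-- adapted from `Literature.AlgebraicGeometry.Resolution.genericPoint_eq_of_isDominant` (AlterationsProofs; lighter imports here)
/-- A dominant morphism of integral schemes maps the generic point to the generic point. [cite: StacksProject, Tag 0CC1] -/
theorem genericPoint_eq_of_isDominant {X' X : Scheme.{0}} (φ : X' ⟶ X) [IsIntegral X'] [IsIntegral X] [IsDominant φ] :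
    φ.base (genericPoint X') = genericPoint X := by
  have h : IsGenericPoint (φ.base (genericPoint X')) (closure (φ.base '' Set.univ)) :=
    (genericPoint_spec X').image φ.continuous
  rw [Set.image_univ, φ.denseRange.closure_range] at h
  exact h.eq (genericPoint_spec X)

/-- A closed immersion reflects closed points: `{j z}` closed ⇒ `{z}` closed. [folklore] -/
theorem isClosed_singleton_of_isClosedImmersion {Y X : Scheme.{0}} (j : Y ⟶ X) [IsClosedImmersion j] (z : Y)
    (hz : IsClosed ({j.base z} : Set X)) : IsClosed ({z} : Set Y) := by
  have h := hz.preimage j.continuous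
  have heq : j.base ⁻¹' {j.base z} = {z} := by
    ext y
    simp only [Set.mem_preimage, Set.mem_singleton_iff]
    exact ⟨fun h => j.isClosedEmbedding.injective h, fun h => by rw [h]⟩
  rwa [heq] at h

/-! ## (B) All points over `b` closed ⇒ `J·𝒪_{B,b}` principal -/

-- adapted from `Literature.AlgebraicGeometry.Resolution.quasiFiniteAt_of_isOpen_singleton` (AlterationsLemma411FibreDimension; lighter imports)
/-- A point which is open in its (set-theoretic) fibre is a quasi-finite point. [folklore] -/
theorem quasiFiniteAt_of_isOpen_singleton {X Y : Scheme.{0}} (f : X ⟶ Y) [LocallyOfFiniteType f]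
    (x : X) (h : IsOpen ({⟨x, rfl⟩} : Set (f ⁻¹' {f x}))) : f.QuasiFiniteAt x := by
  rw [Scheme.Hom.quasiFiniteAt_iff_isOpen_singleton_asFiber,
    ← (f.fiberHomeo (f x)).isOpen_image, Set.image_singleton]
  convert h using 2
  apply Subtype.ext
  rw [Scheme.Hom.fiberHomeo_apply, Scheme.Hom.fiberι_asFiber]

/-- In a Noetherian sober space, a closed set all of whose points are closed is finite (each irreducible component is the closure of its generic
point, a singleton). [folklore] -/
theorem finite_of_isClosed_of_forall_isClosed_singleton {X : Type} [TopologicalSpace X] [NoetherianSpace X] [QuasiSober X]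
    {T : Set X} (hT : IsClosed T) (hcl : ∀ z ∈ T, IsClosed ({z} : Set X)) : T.Finite := by
  classical
  obtain ⟨S, hS, hTS⟩ := NoetherianSpace.exists_finset_irreducible (⟨T, hT⟩ : Closeds X)
  have hTeq : T = ⋃ k ∈ S, (k : Set X) := by
    have h := congrArg (fun c : Closeds X => (c : Set X)) hTS
    simp only [Closeds.coe_finset_sup, Finset.sup_set_eq_biUnion, Function.comp_def, id_eq, Closeds.coe_mk] at h
    exact h
  -- each irreducible component is a singleton
  have hk : ∀ k ∈ S, ∃ z : X, (k : Set X) = {z} := by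
    intro k hkS
    have hirr : IsIrreducible (k : Set X) := hS ⟨k, hkS⟩
    refine ⟨hirr.genericPoint, ?_⟩
    have hgen : IsGenericPoint hirr.genericPoint (k : Set X) := hirr.isGenericPoint_genericPoint k.isClosed
    have hzT : hirr.genericPoint ∈ T := by
      rw [hTeq]
      exact Set.mem_biUnion hkS hgen.mem
    exact (isGenericPoint_def.mp hgen).symm.trans (hcl _ hzT).closure_eq
  choose z hz using hk
  have hfin : (⋃ k ∈ S, (k : Set X)).Finite :=
    S.finite_toSet.biUnion fun k hk' => by rw [hz k hk']; exact Set.finite_singleton _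
  rwa [← hTeq] at hfin

/-- A proper dominant morphism is surjective. [folklore] -/
theorem surjective_of_isProper_of_isDominant {X Y : Scheme.{0}} (f : X ⟶ Y) [IsProper f] [IsDominant f] :
    Function.Surjective f.base := by
  have hcl : IsClosed (Set.range f.base) := f.isClosedMap.isClosed_range
  have hd : Dense (Set.range f.base) := f.denseRange
  intro y
  have : y ∈ Set.range f.base := by rw [← hcl.closure_eq, hd.closure_eq]; trivial
  exact this

set_option maxHeartbeats 800000 in -- one long plumbing proof (restrictions, stalk maps, quasi-finite locus); no change of meaning
/-- **If every point of the blowing up `ρ : B′ → B` (along `I ≠ ⊥`; `B` integral, Noetherian, with integrally closed local rings) over `b` is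
closed, then `I_b` is principal**: the fibre over `b` is finite, so `b` misses the closed image of the non-quasi-finite locus; over the
complementary open `V` the proper, locally quasi-finite `ρ` is finite, birational onto the normal `V`, hence an isomorphism; so
`I_b ≅ (I·𝒪_{B′})_{ζ₀}` is generated by one element. [cite: GortzWedhorn2020, Prop. 12.76] [cite: StacksProject, Tag 02LS] -/
theorem exists_eq_span_of_forall_isClosed {B B' : Scheme.{0}} {I : B.IdealSheafData} {ρ : B' ⟶ B} (hρ : IsBlowup ρ I)
    [IsIntegral B] [IsNoetherian B] (hI : I ≠ ⊥) (hnorm : ∀ y : B, IsIntegrallyClosed (B.presheaf.stalk y))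
    (b : B) (hcl : ∀ ζ : B', ρ.base ζ = b → IsClosed ({ζ} : Set B')) :
    ∃ g : B.presheaf.stalk b, stalkIdeal I b = Ideal.span {g} := by
  classical
  haveI : IsProper ρ := hρ.isProper
  haveI : IsIntegral B' := hρ.isIntegral hI
  haveI : IsDominant ρ := (hρ.isBirational' hI).isDominant
  haveI : IsLocallyNoetherian B' := LocallyOfFiniteType.isLocallyNoetherian ρ
  haveI : CompactSpace B' := QuasiCompact.compactSpace_of_compactSpace ρ
  haveI : IsNoetherian B' := {}
  have hsurj := surjective_of_isProper_of_isDominant ρ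
  -- `b` is a closed point (it is the image of a closed point of `B′`)
  obtain ⟨ζ₀, hζ₀⟩ := hsurj b
  have hb : IsClosed ({b} : Set B) := by
    have h := ρ.isClosedMap _ (hcl ζ₀ hζ₀)
    rwa [Set.image_singleton, hζ₀] at h
  -- (1) the fibre over `b` is finite, hence discrete: every point over `b` is a quasi-finite point of `ρ`
  have hTfin : (ρ.base ⁻¹' {b}).Finite :=
    finite_of_isClosed_of_forall_isClosed_singleton (hb.preimage ρ.continuous) fun z hz => hcl z hz
  have hqf : ∀ ζ : B', ρ.base ζ = b → ρ.QuasiFiniteAt ζ := by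
    intro ζ hζ
    apply quasiFiniteAt_of_isOpen_singleton ρ ζ
    have hfin' : (ρ.base ⁻¹' {ρ.base ζ}).Finite := by rw [hζ]; exact hTfin
    haveI : Finite ↥(ρ.base ⁻¹' {ρ.base ζ}) := hfin'.to_subtype
    haveI : T1Space ↥(ρ.base ⁻¹' {ρ.base ζ}) := by
      refine ⟨fun q => ?_⟩
      have hq : IsClosed ({(q : B')} : Set B') := hcl q (by rw [← hζ]; exact q.2)
      have h : IsClosed ((Subtype.val : ↥(ρ.base ⁻¹' {ρ.base ζ}) → B') ⁻¹' {(q : B')}) :=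
        hq.preimage continuous_subtype_val
      have heq : ((Subtype.val : ↥(ρ.base ⁻¹' {ρ.base ζ}) → B') ⁻¹' {(q : B')}) = {q} := by
        ext r
        simp only [Set.mem_preimage, Set.mem_singleton_iff, Subtype.val_inj]
      rwa [heq] at h
    exact isOpen_discrete _
  -- (2) the open `V ∋ b` over which `ρ` is quasi-finite
  let C : Set B' := ((ρ.quasiFiniteLocus : B'.Opens) : Set B')ᶜ
  have hC : IsClosed C := ρ.quasiFiniteLocus.isOpen.isClosed_compl
  have hCimg : IsClosed (ρ.base '' C) := ρ.isClosedMap _ hC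
  let V : B.Opens := ⟨(ρ.base '' C)ᶜ, hCimg.isOpen_compl⟩
  have hbV : b ∈ V := by
    rintro ⟨ζ, hζC, hζb⟩
    exact hζC (hqf ζ hζb)
  -- (3) `ρ` is finite over `V`
  haveI hlqf : LocallyQuasiFinite (ρ ∣_ V) := by
    rw [← Scheme.Hom.quasiFiniteLocus_eq_top_iff]
    ext x
    simp only [Opens.coe_top, Set.mem_univ, iff_true, SetLike.mem_coe, Scheme.Hom.mem_quasiFiniteLocus]
    have hx : ρ.QuasiFiniteAt ((ρ ⁻¹ᵁ V).ι.base x) := by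
      by_contra hnq
      have hxC : ((ρ ⁻¹ᵁ V).ι.base x) ∈ C := hnq
      have : ρ.base ((ρ ⁻¹ᵁ V).ι.base x) ∈ ρ.base '' C := ⟨_, hxC, rfl⟩
      exact x.2 this
    have h1 : ((ρ ∣_ V) ≫ V.ι).QuasiFiniteAt x := by
      rw [morphismRestrict_ι, Scheme.Hom.quasiFiniteAt_comp_iff_of_isOpenImmersion]
      exact hx
    exact Scheme.Hom.quasiFiniteAt_comp_iff.mp h1
  haveI : IsFinite (ρ ∣_ V) := IsFinite.of_isProper_of_locallyQuasiFinite _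
  -- (4) `ρ` is an isomorphism over `V`: finite birational onto the normal `V`
  haveI : IsDominant (ρ ∣_ V) := IsZariskiLocalAtTarget.restrict ‹IsDominant ρ› V
  haveI : Nonempty (ρ ⁻¹ᵁ V) := ⟨⟨ζ₀, show ρ.base ζ₀ ∈ V from hζ₀ ▸ hbV⟩⟩
  haveI : IsIntegral (ρ ⁻¹ᵁ V) := isIntegral_of_isOpenImmersion (ρ ⁻¹ᵁ V).ι
  haveI : Nonempty V := ⟨⟨b, hbV⟩⟩
  haveI : IsIntegral V := isIntegral_of_isOpenImmersion V.ι
  have hgen : IsIso (ρ.stalkMap (genericPoint B')) := by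
    -- adapted from `IsBlowup.isIso_stalkMap_of_not_mem_support`: the generic point lies over the complement of `supp I`
    have hη : ρ.base (genericPoint B') ∉ I.support := by
      rw [genericPoint_eq_of_isDominant]
      intro hmem
      obtain ⟨y, hy⟩ := centreCompl_nonempty (X := B) hI
      -- `supp I` is closed and contains the generic point, hence everything
      have hcl' : closure ({genericPoint B} : Set B) ⊆ (I.support : Set B) :=
        closure_minimal (Set.singleton_subset_iff.mpr hmem) I.support.isClosed
      rw [genericPoint_closure] at hcl'
      exact hy (hcl' (Set.mem_univ y))
    haveI : IsIso (ρ ∣_ ⟨(I.support : Set B)ᶜ, I.support.isClosed.isOpen_compl⟩) := hρ.isIso_compl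
    exact RegularBlowupModelDim2.isIso_stalkMap_of_isIso_morphismRestrict ρ ⟨(I.support : Set B)ᶜ, I.support.isClosed.isOpen_compl⟩ (genericPoint B') hη
  have hgen' := isIso_stalkMap_morphismRestrict_genericPoint ρ hgen V
  haveI hisoTop : IsIso ((ρ ∣_ V) ∣_ ⊤) :=
    isIso_morphismRestrict_of_isIntegralHom_of_normal (ρ ∣_ V) hgen' ⊤ fun y _ =>
      isIntegrallyClosed_stalk_opens V (fun y _ => hnorm y) y
  -- (5) the stalk map at the point `ζ₀` over `b` is an isomorphism, so `I_b` is principal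
  have hζ₀V : ρ.base ζ₀ ∈ V := hζ₀ ▸ hbV
  have h5 : IsIso ((ρ ∣_ V).stalkMap ⟨ζ₀, hζ₀V⟩) :=
    RegularBlowupModelDim2.isIso_stalkMap_of_isIso_morphismRestrict (ρ ∣_ V) ⊤ ⟨ζ₀, hζ₀V⟩ trivial
  haveI hst : IsIso (ρ.stalkMap ζ₀) :=
    (MorphismProperty.isomorphisms.iff _).mp
      (((MorphismProperty.isomorphisms CommRingCat).arrow_mk_iso_iff (morphismRestrictStalkMap ρ V ⟨ζ₀, hζ₀V⟩)).mp
        ((MorphismProperty.isomorphisms.iff _).mpr h5))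
  let E : B.presheaf.stalk (ρ.base ζ₀) ≃+* B'.presheaf.stalk ζ₀ := (asIso (ρ.stalkMap ζ₀)).commRingCatIsoToRingEquiv
  obtain ⟨t, -, ht⟩ := hρ.isEffectiveCartier.exists_stalkIdeal_eq_span ζ₀
  have hmap : stalkIdeal (I.comap ρ) ζ₀ = (stalkIdeal I (ρ.base ζ₀)).map (E : _ →+* _) :=
    stalkIdeal_comap_eq_map_stalkMap ρ I ζ₀
  subst hζ₀
  refine ⟨E.symm t, ?_⟩
  have h := congrArg (Ideal.map (E.symm : B'.presheaf.stalk ζ₀ →+* B.presheaf.stalk (ρ.base ζ₀))) hmap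
  rw [Ideal.map_of_equiv, ht, Ideal.map_span, Set.image_singleton] at h
  exact h.symm

/-! ## (C) The non-closed point over `b` -/

/-- **WITNESS plumbing.** `π : X₂ → X₁` a blowing up along `J`; `i : B → X₁` a closed immersion with `B` integral, Noetherian and normal and
`J·𝒪_B ≠ 0`; `b ∈ B` with `J·𝒪_{B,b}` NOT principal. Then some point `ζ ∈ X₂` over `b` is NON-closed and is a specialization of the point `η′ ∈ X₂`
over the generic point of `B` (both on the strict transform of `B`). [OURS plumbing] [cite: GortzWedhorn2020, Prop. 13.96 (2)] -/
theorem exists_nonClosed_specializes {X₁ X₂ B : Scheme.{0}} {J : X₁.IdealSheafData} {π : X₂ ⟶ X₁} (hπ : IsBlowup π J)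
    (i : B ⟶ X₁) [IsClosedImmersion i] [IsIntegral B] [IsNoetherian B]
    (hnorm : ∀ y : B, IsIntegrallyClosed (B.presheaf.stalk y)) (hI : J.comap i ≠ ⊥)
    (b : B) (hb : ¬ ∃ g : B.presheaf.stalk b, stalkIdeal (J.comap i) b = Ideal.span {g}) :
    ∃ η' ζ : X₂, π.base η' = i.base (genericPoint B) ∧ π.base ζ = i.base b ∧ η' ⤳ ζ ∧ ¬ IsClosed ({ζ} : Set X₂) := by
  obtain ⟨B', ρ, j, hρ, hj, hcomm⟩ := exists_strictTransform hπ i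
  haveI : IsIntegral B' := hρ.isIntegral hI
  haveI : IsDominant ρ := (hρ.isBirational' hI).isDominant
  -- a non-closed point of `B′` over `b`
  have hnc : ∃ ζ : B', ρ.base ζ = b ∧ ¬ IsClosed ({ζ} : Set B') := by
    by_contra h
    push Not at h
    exact hb (exists_eq_span_of_forall_isClosed hρ hI hnorm b h)
  obtain ⟨ζ, hζb, hζ⟩ := hnc
  refine ⟨j.base (genericPoint B'), j.base ζ, ?_, ?_, ?_, fun hc => hζ (isClosed_singleton_of_isClosedImmersion j ζ hc)⟩
  · rw [← Scheme.Hom.comp_apply, hcomm, Scheme.Hom.comp_apply, genericPoint_eq_of_isDominant]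
  · rw [← Scheme.Hom.comp_apply, hcomm, Scheme.Hom.comp_apply, hζb]
  · exact (genericPoint_specializes ζ).map j.continuous

end Summit.ResolutionOfSingularities.ResolutionOfSingularities.Theorems.FInjectiveMacaulayfication.StrictTransformNonClosed

end
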